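import Summits.ResolutionOfSingularities.ResolutionOfSingularities.Theorems.PurelyInseparableDim4ResConeTranslatedStepWitness
import Summits.ResolutionOfSingularities.ResolutionOfSingularities.Theorems.PurelyInseparableDim4ResConeLSectorKillPrime
import HarnessLib
import HarnessLib.Audit.Tags

/-!
# Purely inseparable four-folds — SLICES ALONG AN UNCHARTED UNTRANSLATED LETTER NEVER MIX (support form)
# (cell `res-dim4-pi`, K2(p) lane, B-LOSSY «heavy-letter slicing» (S1); seat res-dim4-p-8 g7)

[OURS · counted 0 · cell `res-dim4-pi` · K2(p) lane (holder res-dim4-p-12 g5, rulings g5-27: «first STRUCTURE on B-LOSSY»); text res-dim4-p-8 g7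
(bus 2026-08-29 l.6992 (S1)); the two ingredients are res-dim4-p-5 g6's source law (`exists_monomial_of_mem_support_shear`, `exists_of_mem_support_step`)
and res-dim4-p-11 g6's canceller order (`preceq_of_mem_support_shear_monomial`).]  Pure bookkeeping of ONE step `CentreBlowup.step q univ j b`
of OUR frame; nothing here proves any TAIL(p, d, ·), K2(7), K2(p) or resolution of singularities in dimension ≥ 4 / characteristic `p` — NOT
proved.  AI kernel work, weaker than expert review.

* **`exists_source_apply_eq_of_untranslated`** — if the letter `z ≠ j` is not translated at the step (`b z = 0`), every monomial `x^T` of the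
  child comes from a monomial `x^m` of the parent with THE SAME `z`-exponent, `T z = m z` (and `T j = |m| − q`): the `x_z`-slices
  `F = Σ_e x_z^e · F_e` are transformed slice by slice.
* `apply_le_of_forall_apply_le_of_untranslated` — hence a lower bound `m₀ ≤ E z` on the parent's support passes to the child (in the
  heavy-letter regime of `tsector_lossy_heavy_letter`: `m ≤ E z` for every monomial at every late time).
[cite: Hauser2010, §§F–G, §I] bears_on: LADDER-RESOLUTION:D157-DOOR2 (res-dim4-pi · K2(p) · B-LOSSY slicing (S1)).
Supports stmt-ResolutionOfSingularities-16155 (helper).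
-/

set_option linter.dupNamespace false -- mandated namespace of this single-conjunct summit

noncomputable section

namespace Summit.ResolutionOfSingularities.ResolutionOfSingularities.Theorems.PIDim4

namespace ResCone

open MvPolynomial Finset
open Literature.AlgebraicGeometry.Resolution
open Literature.AlgebraicGeometry.Resolution.CentreBlowup
open Literature.AlgebraicGeometry.Resolution.Hauser2010

variable {K : Type} [Field K] [DecidableEq K]

/-- **SLICES ALONG AN UNTRANSLATED NON-CHART LETTER NEVER MIX**: at the point step in the `x_j`-chart at `b` (`b_j = 0`, `q ≤ ord F`), if
`b z = 0` for a letter `z ≠ j`, every monomial `x^T` of the child has a source monomial `x^m ∈ supp F` with `T z = m z` and `T j = |m| − q`.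
[OURS · bookkeeping] [cite: Hauser2010, §§F–G, §I] -/
theorem exists_source_apply_eq_of_untranslated (q : ℕ) (j : Fin 4) {b : Fin 4 → K} (hbj : b j = 0) (s : State K)
    (hq : (q : ℕ∞) ≤ ordAlong Finset.univ s.F) {T : Fin 4 →₀ ℕ}
    (hT : T ∈ (CentreBlowup.step q Finset.univ j b s).F.support) {z : Fin 4} (hzj : z ≠ j) (hbz : b z = 0) :
    ∃ m ∈ s.F.support, T z = m z ∧ T j = m.degree - q := by
  classical
  obtain ⟨e, he, heT, -⟩ := exists_of_mem_support_step q j hbj s hq hT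
  obtain ⟨m, hm, hem⟩ := exists_monomial_of_mem_support_shear j b s.F he
  obtain ⟨hdeg, hfix, -⟩ := preceq_of_mem_support_shear_monomial j hbj m hem
  refine ⟨m, hm, ?_, ?_⟩
  · rw [← heT, chartExponent_apply_of_ne q Finset.univ hzj, hfix z hzj hbz]
  · rw [← heT, chartExponent_univ_apply_self, hdeg]

/-- A lower bound on the `z`-exponents of the parent's support passes to the child when `z ≠ j` is untranslated. [OURS · bookkeeping] -/
theorem apply_le_of_forall_apply_le_of_untranslated (q : ℕ) (j : Fin 4) {b : Fin 4 → K} (hbj : b j = 0) (s : State K)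
    (hq : (q : ℕ∞) ≤ ordAlong Finset.univ s.F) {z : Fin 4} (hzj : z ≠ j) (hbz : b z = 0) {m₀ : ℕ}
    (hF : ∀ m ∈ s.F.support, m₀ ≤ m z) {T : Fin 4 →₀ ℕ} (hT : T ∈ (CentreBlowup.step q Finset.univ j b s).F.support) :
    m₀ ≤ T z := by
  obtain ⟨m, hm, hTz, -⟩ := exists_source_apply_eq_of_untranslated q j hbj s hq hT hzj hbz
  rw [hTz]; exact hF m hm

end ResCone

end Summit.ResolutionOfSingularities.ResolutionOfSingularities.Theorems.PIDim4

end
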